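import Summits.NavierStokesRegularity.OSWSelfSimilar.SheetRResolventComplex
import HarnessLib

/-!
# SHEET-ℝ frame, MODEL ASSEMBLY for Z3-SR-SPEC (P1): the SHARP pivot bound `‖R(σ)‖_{L²_w(ℂ) → L²_w(ℂ)} ≤ 1/(m + Re σ)`

HONEST FRAMING (cell ns-blowup GROUP B / zone Z3, case Z3-SR-SPEC, PAPER item (P1) «`‖ιR(σ)‖ ≤ 1/c_w(σ)`, `c_w(σ) = c₁ + γ + Re σ`»; 1-D MODEL
certificate frame (viscous gCLM/OSW sheet on the line); not Euler/NS; «violates: none — MODEL»). Nothing here asserts that a profile exists;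
the Gårding constant `m` (cert-1's `c₁ + γ`) is the certificate's interval datum, carried by `SheetRResolventComplex.GardingData`.

`SheetRResolventComplex.norm_resolvent_le` bounds `R(σ)` by the Lions constant `8/κ(σ)`.  The sharp constant comes from the energy identity
for the ACTUAL solution pair (which is not a compactly supported test): adding the two cutoff inequalities of `SheetRLinearisedCutoffEnergy`
for `u_R` and `u_I` the skew terms `±t∫w u_R u_I χ_R²` cancel, and letting `R → ∞`,

* `pair_pivot_le_of_weak` — `c(‖u_R‖²_w + ‖u_I‖²_w) ≤ ‖g_R‖_w‖u_R‖_w + ‖g_I‖_w‖u_I‖_w` for an energy-class weak solution pair of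
  `A u_R − t u_I = g_R`, `A u_I + t u_R = g_I` when the form of `A` is `c`-coercive in the pivot norm on tests;
* `pivot_coercive_shift` — under the Gårding bound, the form of `A + s` is `(m + s)`-coercive in the pivot norm (`s > −m`);
* `norm_resolvent_le_inv` — **`‖resolvent σ G‖ ≤ ‖G‖ / (m + Re σ)`** on the half-plane `Re σ > −m` (two-dimensional Cauchy–Schwarz
  `√a√x + √b√y ≤ √(a+b)√(x+y)` to pass from the pair to the complex norms, which are the `ℓ²` norms of the pairs by `norm_toPair`).

Pure functional analysis; no definition, no named fact.  WHAT THIS IS NOT: not NS; no number of record moves.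
-/

noncomputable section

namespace Summit.NavierStokesRegularity.OSWSelfSimilar
namespace SheetRResolventBounds

open _root_.MeasureTheory _root_.Set _root_.Filter _root_.Real SheetRWeakProfilePV SheetRWeakToStrong SheetREnergyClass SheetRWeightedMeasure
  SheetRLinearisedTests SheetREnergySpace SheetRTestSpace SheetRLinearisedFormBounds SheetRSolutionOperator SheetRLinearisedCutoffEnergy
  SheetRLinearisedUniqueness SheetRResolventPair SheetRComplexPivot SheetRResolventComplex
open scoped Topology ENNReal

/-! ### §1 The pivot inequality for a weak solution PAIR -/

section Pair

variable {L D₀ D₁ V₀ : ℝ} {d V uR uR₁ uI uI₁ gR gI : ℝ → ℝ}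

/-- **Pivot inequality for the skew-coupled pair.**  `(u_R, u_I)` in the odd energy class solving
`linForm(u_R; φ) − t∫w u_I φ = ∫w g_R φ`, `linForm(u_I; φ) + t∫w u_R φ = ∫w g_I φ` on every compactly supported test, `g_R, g_I ∈ L²_w`, and
the form `c`-coercive in the pivot norm on tests (`c > 0`): `c(‖u_R‖²_w + ‖u_I‖²_w) ≤ ‖g_R‖_w‖u_R‖_w + ‖g_I‖_w‖u_I‖_w`. [folklore] -/
theorem pair_pivot_le_of_weak (hL : 0 < L) (hdm : AEStronglyMeasurable d volume) (hVm : AEStronglyMeasurable V volume)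
    (hD₀ : 0 ≤ D₀) (hD₁ : 0 ≤ D₁) (hd : ∀ ξ, |d ξ| ≤ D₀ + D₁ * |ξ|) (hV : ∀ ξ, |V ξ| ≤ V₀) {c : ℝ} (hc : 0 < c)
    (hcoerw : ∀ v v₁ : ℝ → ℝ, IsCompactTest v v₁ → c * ∫ ξ, (L ^ 2 + ξ ^ 2) * v ξ ^ 2 ≤ linForm L d V v v₁ v v₁)
    (huR : ∀ x, uR x = uR 0 + ∫ s in (0 : ℝ)..x, uR₁ s) (hoddR : ∀ y, uR (-y) = -uR y) (huR₁m : AEStronglyMeasurable uR₁ volume)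
    (h0R : Integrable fun y => (L ^ 2 + y ^ 2) * uR y ^ 2) (h1R : Integrable fun y => (L ^ 2 + y ^ 2) * uR₁ y ^ 2)
    (huI : ∀ x, uI x = uI 0 + ∫ s in (0 : ℝ)..x, uI₁ s) (hoddI : ∀ y, uI (-y) = -uI y) (huI₁m : AEStronglyMeasurable uI₁ volume)
    (h0I : Integrable fun y => (L ^ 2 + y ^ 2) * uI y ^ 2) (h1I : Integrable fun y => (L ^ 2 + y ^ 2) * uI₁ y ^ 2)
    (hgRm : AEStronglyMeasurable gR volume) (hgR : Integrable fun y => (L ^ 2 + y ^ 2) * gR y ^ 2)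
    (hgIm : AEStronglyMeasurable gI volume) (hgI : Integrable fun y => (L ^ 2 + y ^ 2) * gI y ^ 2) (t : ℝ)
    (hweakR : ∀ φ φ₁ : ℝ → ℝ, IsCompactTest φ φ₁ →
      linForm L d V uR uR₁ φ φ₁ - t * ∫ y, (L ^ 2 + y ^ 2) * (uI y * φ y) = ∫ y, (L ^ 2 + y ^ 2) * (gR y * φ y))
    (hweakI : ∀ φ φ₁ : ℝ → ℝ, IsCompactTest φ φ₁ →
      linForm L d V uI uI₁ φ φ₁ + t * ∫ y, (L ^ 2 + y ^ 2) * (uR y * φ y) = ∫ y, (L ^ 2 + y ^ 2) * (gI y * φ y)) :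
    c * ((∫ ξ, (L ^ 2 + ξ ^ 2) * uR ξ ^ 2) + ∫ ξ, (L ^ 2 + ξ ^ 2) * uI ξ ^ 2) ≤
      Real.sqrt (∫ y, (L ^ 2 + y ^ 2) * gR y ^ 2) * Real.sqrt (∫ y, (L ^ 2 + y ^ 2) * uR y ^ 2)
        + Real.sqrt (∫ y, (L ^ 2 + y ^ 2) * gI y ^ 2) * Real.sqrt (∫ y, (L ^ 2 + y ^ 2) * uI y ^ 2) := by
  obtain ⟨huRc, huR₁2, huR2, -, -⟩ := basic_of_primitive hL huR huR₁m h0R h1R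
  obtain ⟨huIc, huI₁2, huI2, -, -⟩ := basic_of_primitive hL huI huI₁m h0I h1I
  obtain ⟨M, hM0, hM⟩ := exists_deriv_cutoff_le
  set C : ℝ := M ^ 2 + 4 * M / L ^ 2 + M * (D₀ + 2 * D₁) with hC
  set IR : ℝ := ∫ ξ, (L ^ 2 + ξ ^ 2) * uR ξ ^ 2 with hIR
  set II : ℝ := ∫ ξ, (L ^ 2 + ξ ^ 2) * uI ξ ^ 2 with hII
  set A : ℝ := Real.sqrt (∫ y, (L ^ 2 + y ^ 2) * gR y ^ 2) * Real.sqrt IR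
    + Real.sqrt (∫ y, (L ^ 2 + y ^ 2) * gI y ^ 2) * Real.sqrt II with hA
  set TR : ℕ → ℝ := fun n => ∫ ξ in {ξ : ℝ | ((n : ℝ) + 1) ^ 2 ≤ ξ ^ 2}, (L ^ 2 + ξ ^ 2) * uR ξ ^ 2 with hTR
  set TI : ℕ → ℝ := fun n => ∫ ξ in {ξ : ℝ | ((n : ℝ) + 1) ^ 2 ≤ ξ ^ 2}, (L ^ 2 + ξ ^ 2) * uI ξ ^ 2 with hTI
  have hstep : ∀ n : ℕ, c * (IR + II) ≤ A + (C + c) * (TR n + TI n) := by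
    intro n
    have hR : (1 : ℝ) ≤ (n : ℝ) + 1 := by
      have : (0 : ℝ) ≤ n := Nat.cast_nonneg n
      linarith
    have hR0 : (0 : ℝ) < (n : ℝ) + 1 := by linarith
    have hmeas : MeasurableSet {ξ : ℝ | ((n : ℝ) + 1) ^ 2 ≤ ξ ^ 2} := measurableSet_le measurable_const (by fun_prop)
    obtain ⟨htR, -⟩ := isCompactTest_cutoff_mul hR0 huR hoddR huR₁2 huR2
    obtain ⟨htI, -⟩ := isCompactTest_cutoff_mul hR0 huI hoddI huI₁2 huI2
    have htR2 := isCompactTest_cutoff_sq_mul hR0 huR hoddR huR₁2 huR2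
    have htI2 := isCompactTest_cutoff_sq_mul hR0 huI hoddI huI₁2 huI2
    have hcoR := hcoerw _ _ htR
    have hcoI := hcoerw _ _ htI
    have hcutR := linForm_cutoff_le hL hdm hVm hD₀ hD₁ hd hV huR huR₁m h0R h1R hM0 hR (hM _ hR0)
    have hcutI := linForm_cutoff_le hL hdm hVm hD₀ hD₁ hd hV huI huI₁m h0I h1I hM0 hR (hM _ hR0)
    have hwR := hweakR _ _ htR2
    have hwI := hweakI _ _ htI2
    -- the cross terms cancel
    have hcross : ∫ y, (L ^ 2 + y ^ 2) * (uI y * (cutoff ((n : ℝ) + 1) y * (cutoff ((n : ℝ) + 1) y * uR y))) =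
        ∫ y, (L ^ 2 + y ^ 2) * (uR y * (cutoff ((n : ℝ) + 1) y * (cutoff ((n : ℝ) + 1) y * uI y))) :=
      integral_congr_ae (Eventually.of_forall fun y => by ring)
    have hdatR := abs_data_cutoff_le (L := L) ((n : ℝ) + 1) hgRm hgR huRc h0R
    have hdatI := abs_data_cutoff_le (L := L) ((n : ℝ) + 1) hgIm hgI huIc h0I
    have habR := le_abs_self (∫ y, (L ^ 2 + y ^ 2) * (gR y * (cutoff ((n : ℝ) + 1) y * (cutoff ((n : ℝ) + 1) y * uR y))))
    have habI := le_abs_self (∫ y, (L ^ 2 + y ^ 2) * (gI y * (cutoff ((n : ℝ) + 1) y * (cutoff ((n : ℝ) + 1) y * uI y))))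
    have hplatR := (plateau_mass_le (L := L) hR0 huRc h0R).2
    have hplatI := (plateau_mass_le (L := L) hR0 huIc h0I).2
    have hsR : ∫ ξ in {ξ : ℝ | ((n : ℝ) + 1) ^ 2 ≤ ξ ^ 2}ᶜ, (L ^ 2 + ξ ^ 2) * uR ξ ^ 2 = IR - TR n := by
      rw [hIR, hTR, ← integral_add_compl hmeas h0R]; ring
    have hsI : ∫ ξ in {ξ : ℝ | ((n : ℝ) + 1) ^ 2 ≤ ξ ^ 2}ᶜ, (L ^ 2 + ξ ^ 2) * uI ξ ^ 2 = II - TI n := by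
      rw [hII, hTI, ← integral_add_compl hmeas h0I]; ring
    rw [hsR] at hplatR
    rw [hsI] at hplatI
    rw [hcross] at hwR
    nlinarith [mul_le_mul_of_nonneg_left hplatR hc.le, mul_le_mul_of_nonneg_left hplatI hc.le]
  have hlim : Tendsto (fun n : ℕ => A + (C + c) * (TR n + TI n)) atTop (𝓝 (A + (C + c) * (0 + 0))) :=
    tendsto_const_nhds.add (((tendsto_tail h0R).add (tendsto_tail h0I)).const_mul (C + c))
  rw [add_zero, mul_zero, add_zero] at hlim
  exact ge_of_tendsto' hlim hstep

end Pair

/-! ### §2 Two-dimensional Cauchy–Schwarz and the pivot coercivity of the shifted form -/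

/-- `√a·√x + √b·√y ≤ √(a+b)·√(x+y)` for `a, b, x, y ≥ 0`. [folklore] -/
theorem sqrt_mul_add_sqrt_mul_le {a b x y : ℝ} (ha : 0 ≤ a) (hb : 0 ≤ b) (hx : 0 ≤ x) (hy : 0 ≤ y) :
    Real.sqrt a * Real.sqrt x + Real.sqrt b * Real.sqrt y ≤ Real.sqrt (a + b) * Real.sqrt (x + y) := by
  set p := Real.sqrt a
  set q := Real.sqrt b
  set r := Real.sqrt x
  set s := Real.sqrt y
  have hp : 0 ≤ p := Real.sqrt_nonneg _
  have hq : 0 ≤ q := Real.sqrt_nonneg _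
  have hr : 0 ≤ r := Real.sqrt_nonneg _
  have hs : 0 ≤ s := Real.sqrt_nonneg _
  have ha' : a = p ^ 2 := (Real.sq_sqrt ha).symm
  have hb' : b = q ^ 2 := (Real.sq_sqrt hb).symm
  have hx' : x = r ^ 2 := (Real.sq_sqrt hx).symm
  have hy' : y = s ^ 2 := (Real.sq_sqrt hy).symm
  have hsq : (p * r + q * s) ^ 2 ≤ (p ^ 2 + q ^ 2) * (r ^ 2 + s ^ 2) := by nlinarith [sq_nonneg (p * s - q * r)]
  have hnn : 0 ≤ p * r + q * s := by positivity
  calc p * r + q * s = Real.sqrt ((p * r + q * s) ^ 2) := (Real.sqrt_sq hnn).symm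
    _ ≤ Real.sqrt ((p ^ 2 + q ^ 2) * (r ^ 2 + s ^ 2)) := Real.sqrt_le_sqrt hsq
    _ = Real.sqrt (p ^ 2 + q ^ 2) * Real.sqrt (r ^ 2 + s ^ 2) := Real.sqrt_mul (by positivity) _
    _ = Real.sqrt (a + b) * Real.sqrt (x + y) := by rw [ha', hb', hx', hy']

variable {L D₀ D₁ V₀ m : ℝ} {d V : ℝ → ℝ}

/-- **Pivot coercivity of the shifted form**: under the Gårding bound, `(m + s)‖v‖²_w ≤ linForm L d (V + s) v v₁ v v₁` on every compactly
supported test. [folklore] -/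
theorem pivot_coercive_shift (hL : 0 < L) (h : GardingData L d V D₀ D₁ V₀ m) (s : ℝ) (v v₁ : ℝ → ℝ) (hv : IsCompactTest v v₁) :
    (m + s) * ∫ ξ, (L ^ 2 + ξ ^ 2) * v ξ ^ 2 ≤ linForm L d (fun ξ => V ξ + s) v v₁ v v₁ := by
  obtain ⟨hc, -, -, -⟩ := basic_of_isCompactTest hv
  obtain ⟨hwv, hwv₁⟩ := weighted_of_isCompactTest (L := L) hv
  obtain ⟨-, hshift⟩ := linForm_shift h hL s hv hc.aestronglyMeasurable hv.memLp.1 hwv hwv₁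
  have e : ∫ y, (L ^ 2 + y ^ 2) * (v y * v y) = ∫ y, (L ^ 2 + y ^ 2) * v y ^ 2 :=
    integral_congr_ae (Eventually.of_forall fun y => by ring)
  rw [hshift, e]
  have hG := h.garding v v₁ hv
  have hn1 : 0 ≤ ∫ ξ, (L ^ 2 + ξ ^ 2) * v₁ ξ ^ 2 := integral_nonneg fun y => by positivity
  nlinarith

/-! ### §3 The sharp bound for the complex resolvent -/

/-- **`‖R(σ)G‖ ≤ ‖G‖/(m + Re σ)`** on the half-plane `Re σ > −m` — Z3-SR-SPEC (P1)'s `‖ιR(σ)‖ ≤ 1/c_w(σ)` with `c_w(σ) = m + Re σ`. [folklore] -/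
theorem norm_resolvent_le_inv (hL : 0 < L) (h : GardingData L d V D₀ D₁ V₀ m) {σ : ℂ} (hσ : -m < σ.re) (G : Wc L) :
    ‖resolvent hL h σ G‖ ≤ ‖G‖ / (m + σ.re) := by
  have hc : 0 < m + σ.re := by linarith
  obtain ⟨happ, -, -, hweak⟩ := resolvent_weak hL h hσ G
  set P := pairOp hL h σ hσ (toPair L G) with hP
  obtain ⟨huR, hoR, hmR, h0R, h1R, -, -⟩ := energyClass_of_mem hL P.fst
  obtain ⟨huI, hoI, hmI, h0I, h1I, -, -⟩ := energyClass_of_mem hL P.snd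
  obtain ⟨hVs, hVb⟩ := shift_hyps h σ.re
  -- the pair inequality for the profiles of `P` with data `(Re G, Im G)`
  have hpair := pair_pivot_le_of_weak hL h.d_meas hVs h.D₀_nonneg h.D₁_nonneg h.d_le hVb hc
    (pivot_coercive_shift hL h σ.re) huR hoR hmR h0R h1R huI hoI hmI h0I h1I
    (aestronglyMeasurable_of_W hL (reW L G)) (weightedSq_of_W hL (reW L G))
    (aestronglyMeasurable_of_W hL (imW L G)) (weightedSq_of_W hL (imW L G)) σ.im
    (fun φ φ₁ hφ => (hweak φ φ₁ hφ).1) (fun φ φ₁ hφ => (hweak φ φ₁ hφ).2)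
  -- norms: `‖R(σ)G‖² = I_R + I_I`, `‖G‖² = ‖Re G‖² + ‖Im G‖²`
  set IR : ℝ := ∫ ξ, (L ^ 2 + ξ ^ 2) * prim (der P.fst) ξ ^ 2 with hIR
  set II : ℝ := ∫ ξ, (L ^ 2 + ξ ^ 2) * prim (der P.snd) ξ ^ 2 with hII
  have hIRnn : 0 ≤ IR := integral_nonneg fun ξ => by positivity
  have hIInn : 0 ≤ II := integral_nonneg fun ξ => by positivity
  have hnormR : ‖resolvent hL h σ G‖ = Real.sqrt (IR + II) := by
    rw [happ, norm_ofPair]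
    obtain ⟨h1, h2⟩ := ιpair_fst_snd hL P
    have hsq : ‖ιpair hL P‖ ^ 2 = IR + II := by
      rw [WithLp.prod_norm_sq_eq_of_L2, h1, h2, (norm_ιE_le hL P.fst).1, (norm_ιE_le hL P.snd).1, Real.sq_sqrt hIRnn,
        Real.sq_sqrt hIInn]
    rw [← hsq, Real.sqrt_sq (norm_nonneg _)]
  have hnormG : ‖G‖ = Real.sqrt ((∫ y, (L ^ 2 + y ^ 2) * ((reW L G : W L) : ℝ → ℝ) y ^ 2) +
      ∫ y, (L ^ 2 + y ^ 2) * ((imW L G : W L) : ℝ → ℝ) y ^ 2) := by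
    rw [← norm_toPair G]
    obtain ⟨h1, h2⟩ := toPair_fst_snd G
    have hsq : ‖toPair L G‖ ^ 2 = (∫ y, (L ^ 2 + y ^ 2) * ((reW L G : W L) : ℝ → ℝ) y ^ 2) +
        ∫ y, (L ^ 2 + y ^ 2) * ((imW L G : W L) : ℝ → ℝ) y ^ 2 := by
      rw [WithLp.prod_norm_sq_eq_of_L2, h1, h2, sq_norm_W, sq_norm_W]
    rw [← hsq, Real.sqrt_sq (norm_nonneg _)]
  have hAnn : 0 ≤ ∫ y, (L ^ 2 + y ^ 2) * ((reW L G : W L) : ℝ → ℝ) y ^ 2 := integral_nonneg fun y => by positivity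
  have hBnn : 0 ≤ ∫ y, (L ^ 2 + y ^ 2) * ((imW L G : W L) : ℝ → ℝ) y ^ 2 := integral_nonneg fun y => by positivity
  have hcs := sqrt_mul_add_sqrt_mul_le hAnn hBnn hIRnn hIInn
  have hmain : (m + σ.re) * (IR + II) ≤ ‖G‖ * Real.sqrt (IR + II) := by
    rw [hnormG]; exact hpair.trans hcs
  rw [hnormR, le_div_iff₀ hc]
  rcases (Real.sqrt_nonneg (IR + II)).eq_or_lt with hz | hpos
  · rw [← hz, zero_mul]; exact norm_nonneg _
  · have h2 : (m + σ.re) * Real.sqrt (IR + II) * Real.sqrt (IR + II) ≤ ‖G‖ * Real.sqrt (IR + II) := by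
      rw [mul_assoc, Real.mul_self_sqrt (by positivity)]; exact hmain
    have := le_of_mul_le_mul_right h2 hpos
    linarith

end SheetRResolventBounds
end Summit.NavierStokesRegularity.OSWSelfSimilar

end
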